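import Mathlib
import HarnessLib
import Summits.ResolutionOfSingularities.ResolutionOfSingularities.Theorems.WildQuotientsWildQuotientResolutionThirdConeDefs
import Summits.ResolutionOfSingularities.ResolutionOfSingularities.Theorems.WildQuotientsWildQuotientResolutionJordanThreeChartsA
import Summits.ResolutionOfSingularities.ResolutionOfSingularities.Theorems.WildQuotientsWildQuotientResolutionToricExitRootSubstInjective

/-!
# Theorem T3, chart (R): the cube charts `D₊(x_z³ t)` of `Bl_𝔪 ⅓(1^a,2^b) × 𝔸^c` are affine spaces
(crux stmt-ResolutionOfSingularities-15640 `WildQuotients.WildQuotientResolution`, line `Sketch`;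
chain w45c NEXT RUNG R-T, res-L1-w45c-idea-2's RT-LADDER v1.2 §5 «conjecture T3», res-L1-w45c-plan-1
GO 2026-08-27T10:03:49Z; vocabulary `ThirdCone.*` of `…ThirdConeDefs` (p522660); [OURS · L1 W4.5c] —
NOT a statement of any manuscript; replaces the role of no printed item. Prover res-L1-w45c-stub-2.)

For a weight `w : Fin n → ZMod 3` and a variable `z` of non-zero weight, the chart of the blow-up of
the cone `ThirdCone.cone k n w` along the reduced vertex ideal `ThirdCone.vertexIdeal` at the vertex
generator `x_z³` has chart ring the POLYNOMIAL ring `k[x_z³, x_s x_z^{3-d_s}/x_z³ (s ≠ z)]`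
(`d_s ∈ {0,1,2}` with `d_s · w_z = w_s`): `ThirdCone.isRegularRing_chartRing_cube`. The proof is an
explicit chart map `φ : k[X] → cone[1/x_z³]` with range the affine blow-up algebra
(`JordanThree.range_eq_blowupAlgebra_of_chart`: every weight-`0` monomial `x^e` is
`φ(x_z^N ∏_{s≠z} x_s^{e_s})`, `3N = e_z + ∑_{s≠z} d_s e_s`) and injective (after `cone ↪ k[x]`,
localising at `x_z` and the substitution `x_s ↦ x_s x_z^{d_s}` it becomes `x_z ↦ x_z³`,
`ToricExit.powSubst_injective`), hence `JordanThree.isRegularRing_chartRing_of_chart`.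
Also: small tools (`eq_one_or_eq_two_of_ne_zero`, `vertexGen_mem_vertexIdeal`,
`monomial_one_eq_prod_X_pow`, `weight_eq_sum`, `exists_pos_vertexExp`).
-/

-- single-problem summit: the doubled namespace component `ResolutionOfSingularities` is forced
set_option linter.dupNamespace false

noncomputable section

open MvPolynomial IsLocalization
open Literature.AlgebraicGeometry.Resolution

namespace Summit.ResolutionOfSingularities.ResolutionOfSingularities.Theorems.WildQuotientResolution.ThirdCone

variable (k : Type) [Field k] (n : ℕ) (w : Fin n → ZMod 3)

/-! ## Small tools -/

/-- A non-zero element of `ZMod 3` is `1` or `2`. [folklore] -/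
theorem eq_one_or_eq_two_of_ne_zero : ∀ b : ZMod 3, b ≠ 0 → b = 1 ∨ b = 2 := by decide

/-- The vertex generators lie in the vertex ideal. [OURS · L1 W4.5c] -/
theorem vertexGen_mem_vertexIdeal (v : VIdx n w) :
    vertexGen k n w v ∈ Ideal.span (Set.range (vertexFamily k n w)) :=
  Ideal.subset_span ⟨Fintype.equivFin (VIdx n w) v, by simp [vertexFamily]⟩

/-- A monomial is the product of the powers of the variables. [folklore] -/
theorem monomial_one_eq_prod_X_pow (e : Fin n →₀ ℕ) :
    (monomial e (1 : k) : MvPolynomial (Fin n) k) = ∏ s, X s ^ e s := by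
  classical
  rw [← MvPolynomial.prod_X_pow_eq_monomial]
  exact Finset.prod_subset (Finset.subset_univ _) fun s _ hs => by
    rw [Finsupp.notMem_support_iff.mp hs, pow_zero]

/-- The weight of an exponent as a sum over all variables. [folklore] -/
theorem weight_eq_sum (e : Fin n →₀ ℕ) : Finsupp.weight w e = ∑ s, (e s : ZMod 3) * w s := by
  classical
  rw [Finsupp.weight_apply, Finsupp.sum_fintype _ _ (fun i => by simp)]
  simp only [nsmul_eq_mul]

/-- Every vertex exponent involves a non-passenger variable. [OURS · L1 W4.5c] -/
theorem exists_pos_vertexExp (v : VIdx n w) : ∃ s, w s ≠ 0 ∧ 1 ≤ vertexExp n w v s := by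
  rcases v with ⟨i, j, l⟩ | ⟨i, j, l⟩ | ⟨i, j⟩
  · refine ⟨i.1, by rw [i.2]; decide, ?_⟩
    simp only [vertexExp, Finsupp.add_apply, Finsupp.single_eq_same]; omega
  · refine ⟨i.1, by rw [i.2]; decide, ?_⟩
    simp only [vertexExp, Finsupp.add_apply, Finsupp.single_eq_same]; omega
  · refine ⟨i.1, by rw [i.2]; decide, ?_⟩
    simp only [vertexExp, Finsupp.add_apply, Finsupp.single_eq_same]; omega

/-! ## The vertex chart `D₊(x_z³ t)` is an affine space -/

-- many small identities in the localisation; the proof is an explicit chart map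
set_option maxHeartbeats 2000000 in
/-- **(R) The cube chart.** If the `j`-th vertex generator is `x_z³` (`w z ≠ 0`), the chart ring
`(cone[𝔪t])_{(x_z³ t)}` of `Bl_𝔪 ⅓(w)` is the polynomial ring
`k[x_z³, x_s x_z^{3-d_s}/x_z³ (s ≠ z)]` (`d_s ∈ {0,1,2}`, `d_s w_z = w_s`), in particular regular.
[OURS · L1 W4.5c] -/
theorem isRegularRing_chartRing_cube (j : Fin (Fintype.card (VIdx n w))) (z : Fin n)
    (hz : w z ≠ 0)
    (hj : ((vertexFamily k n w j : cone k n w) : MvPolynomial (Fin n) k) = X z ^ 3) :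
    IsRegularRing (chartRing (vertexFamily k n w) j) := by
  classical
  -- notation
  let c := vertexFamily k n w
  let g : cone k n w := c j
  let L := Localization.Away g
  let am : cone k n w →+* L := algebraMap _ L
  let ι : L := IsLocalization.Away.invSelf g
  have hinv : am g * ι = 1 := IsLocalization.Away.mul_invSelf (S := L) g
  have hg : ((g : cone k n w) : MvPolynomial (Fin n) k) = X z ^ 3 := hj
  haveI : IsRegularRing (MvPolynomial (Fin n) k) := MvPolynomial.isRegularRing_of_isRegularRing k
  have h3 : (3 : ZMod 3) = 0 := by decide
  -- the exponent shift `d`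
  let d : Fin n → ℕ := fun s => if w s = 0 then 0 else if w s = w z then 1 else 2
  have hd_le : ∀ s, d s ≤ 2 := fun s => by
    simp only [d]; split_ifs <;> omega
  have hd0 : ∀ s, w s = 0 → d s = 0 := fun s hs => by simp [d, hs]
  have hdpos : ∀ s, w s ≠ 0 → 1 ≤ d s := fun s hs => by
    simp only [d, hs, if_false]; split_ifs <;> omega
  have hdw : ∀ s, ((d s : ℕ) : ZMod 3) * w z = w s := by
    intro s
    have key : ∀ a b : ZMod 3, b ≠ 0 →
        (((if a = 0 then 0 else if a = b then 1 else 2 : ℕ) : ZMod 3)) * b = a := by decide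
    exact key (w s) (w z) hz
  -- the chart numerators `m s = x_s x_z^{3 - d s}`
  have hm_mem : ∀ s, (X s * X z ^ (3 - d s) : MvPolynomial (Fin n) k) ∈ cone k n w := by
    intro s
    rw [mem_cone_iff]
    have h := (isWeightedHomogeneous_X k w s).mul ((isWeightedHomogeneous_X k w z).pow (3 - d s))
    have hcast : ((3 - d s : ℕ) : ZMod 3) = 3 - (d s : ZMod 3) := by
      have := hd_le s
      rw [Nat.cast_sub (by omega)]; norm_num
    have hdeg : w s + (3 - d s) • w z = 0 := by
      rw [nsmul_eq_mul, hcast]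
      linear_combination (-1 : ZMod 3) * hdw s + (w z) * h3
    rwa [hdeg] at h
  let mA : Fin n → cone k n w := fun s => ⟨X s * X z ^ (3 - d s), hm_mem s⟩
  have hmA : ∀ s, ((mA s : cone k n w) : MvPolynomial (Fin n) k) = X s * X z ^ (3 - d s) :=
    fun s => rfl
  -- the numerators lie in the vertex ideal
  have hmA_mem : ∀ s, s ≠ z → mA s ∈ Ideal.span (Set.range c) := by
    intro s hs
    by_cases hs0 : w s = 0
    · -- passenger: `x_s x_z³ = x_s · g`
      have hXs : (X s : MvPolynomial (Fin n) k) ∈ cone k n w := by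
        rw [mem_cone_iff]; simpa [hs0] using isWeightedHomogeneous_X k w s
      have h30 : 3 - d s = 3 := by rw [hd0 s hs0]
      have : mA s = ⟨X s, hXs⟩ * g :=
        Subtype.ext (by rw [Subalgebra.coe_mul, hmA, hg, h30])
      rw [this]
      exact Ideal.mul_mem_left _ _ (Ideal.subset_span ⟨j, rfl⟩)
    · rcases eq_one_or_eq_two_of_ne_zero (w z) hz with hz1 | hz2
      · by_cases hsz : w s = w z
        · -- same weight `1`: the triple `(s, z, z)`
          have h31 : 3 - d s = 2 := by simp [d, hsz, hz]
          have hs1 : w s = 1 := hsz.trans hz1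
          have : mA s = vertexGen k n w (Sum.inl (⟨s, hs1⟩, ⟨z, hz1⟩, ⟨z, hz1⟩)) := Subtype.ext (by
            rw [hmA, coe_vertexGen, vertexExp, h31, add_assoc, ← Finsupp.single_add,
              X_pow_eq_monomial, X, monomial_mul, one_mul])
          rw [this]; exact vertexGen_mem_vertexIdeal k n w _
        · -- opposite weight: `w s = 2`, the pair `(z, s)`
          have h32 : 3 - d s = 1 := by simp [d, hs0, hsz]
          have hs2 : w s = 2 := by
            rcases eq_one_or_eq_two_of_ne_zero (w s) hs0 with h | h
            · exact absurd (h.trans hz1.symm) hsz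
            · exact h
          have : mA s = vertexGen k n w (Sum.inr (Sum.inr (⟨z, hz1⟩, ⟨s, hs2⟩))) := Subtype.ext (by
            rw [hmA, coe_vertexGen, vertexExp, h32, pow_one, add_comm, X, X, monomial_mul, one_mul])
          rw [this]; exact vertexGen_mem_vertexIdeal k n w _
      · by_cases hsz : w s = w z
        · -- same weight `2`: the triple `(s, z, z)`
          have h31 : 3 - d s = 2 := by simp [d, hsz, hz]
          have hs2 : w s = 2 := hsz.trans hz2
          have : mA s = vertexGen k n w (Sum.inr (Sum.inl (⟨s, hs2⟩, ⟨z, hz2⟩, ⟨z, hz2⟩))) :=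
            Subtype.ext (by
              rw [hmA, coe_vertexGen, vertexExp, h31, add_assoc, ← Finsupp.single_add,
                X_pow_eq_monomial, X, monomial_mul, one_mul])
          rw [this]; exact vertexGen_mem_vertexIdeal k n w _
        · -- opposite weight: `w s = 1`, the pair `(s, z)`
          have h32 : 3 - d s = 1 := by simp [d, hs0, hsz]
          have hs1 : w s = 1 := by
            rcases eq_one_or_eq_two_of_ne_zero (w s) hs0 with h | h
            · exact h
            · exact absurd (h.trans hz2.symm) hsz
          have : mA s = vertexGen k n w (Sum.inr (Sum.inr (⟨s, hs1⟩, ⟨z, hz2⟩))) := Subtype.ext (by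
            rw [hmA, coe_vertexGen, vertexExp, h32, pow_one, X, X, monomial_mul, one_mul])
          rw [this]; exact vertexGen_mem_vertexIdeal k n w _
  -- the chart map `φ : x_z ↦ x_z³, x_s ↦ m_s / x_z³`
  let v : Fin n → L := fun s => if s = z then am g else am (mA s) * ι
  let φ : MvPolynomial (Fin n) k →ₐ[k] L := aeval v
  have hφz : φ (X z) = am g := by simp [φ, v]
  have hφs : ∀ s, s ≠ z → φ (X s) = am (mA s) * ι := fun s hs => by simp [φ, v, hs]
  have hφC : ∀ r : k, φ (C r) = am (algebraMap k (cone k n w) r) := fun r => by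
    rw [aeval_C, IsScalarTower.algebraMap_apply k (cone k n w) L]
  -- (I) values in the blow-up algebra
  have hmem : ∀ x, (φ : MvPolynomial (Fin n) k →+* L) x ∈
      blowupAlgebra (Ideal.span (Set.range c)) (c j) := by
    intro x
    induction x using MvPolynomial.induction_on with
    | C r => rw [RingHom.coe_coe, hφC]; exact Subalgebra.algebraMap_mem _ _
    | add p q hp hq => rw [map_add]; exact Subalgebra.add_mem _ hp hq
    | mul_X p s hp =>
      rw [map_mul]
      refine Subalgebra.mul_mem _ hp ?_
      by_cases hs : s = z
      · rw [hs, RingHom.coe_coe, hφz]; exact Subalgebra.algebraMap_mem _ _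
      · rw [RingHom.coe_coe, hφs s hs]; exact div_mem_blowupAlgebra _ _ (hmA_mem s hs)
  -- (II) the master monomial identity
  let D : (Fin n →₀ ℕ) → ℕ := fun e => ∑ s ∈ Finset.univ.erase z, d s * e s
  have hdiv : ∀ e : Fin n →₀ ℕ, Finsupp.weight w e = 0 → 3 ∣ e z + D e := by
    intro e he
    rw [weight_eq_sum, ← Finset.add_sum_erase _ _ (Finset.mem_univ z)] at he
    have hsum : ∑ s ∈ Finset.univ.erase z, (e s : ZMod 3) * w s =
        ((D e : ℕ) : ZMod 3) * w z := by
      simp only [D, Nat.cast_sum, Nat.cast_mul, Finset.sum_mul]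
      refine Finset.sum_congr rfl fun s _ => ?_
      rw [← hdw s]; ring
    rw [hsum, ← add_mul, ← Nat.cast_add] at he
    rcases mul_eq_zero.mp he with h | h
    · exact (ZMod.natCast_eq_zero_iff _ _).mp h
    · exact absurd h hz
  have master : ∀ (e : Fin n →₀ ℕ) (he : Finsupp.weight w e = 0) (N : ℕ), e z + D e = 3 * N →
      φ (X z ^ N * ∏ s ∈ Finset.univ.erase z, X s ^ e s) =
        am ⟨monomial e 1, monomial_mem_cone k n w he 1⟩ := by
    intro e he N hN
    have hP : φ (∏ s ∈ Finset.univ.erase z, X s ^ e s) =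
        (∏ s ∈ Finset.univ.erase z, am (mA s) ^ e s) * ι ^ (∑ s ∈ Finset.univ.erase z, e s) := by
      rw [map_prod, ← Finset.prod_pow_eq_pow_sum, ← Finset.prod_mul_distrib]
      refine Finset.prod_congr rfl fun s hs => ?_
      rw [map_pow, hφs s (Finset.ne_of_mem_erase hs), mul_pow]
    have hL : φ (X z ^ N * ∏ s ∈ Finset.univ.erase z, X s ^ e s) =
        am g ^ N * (∏ s ∈ Finset.univ.erase z, am (mA s) ^ e s) *
          ι ^ (∑ s ∈ Finset.univ.erase z, e s) := by
      rw [map_mul, map_pow, hφz, hP]; ring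
    -- the identity in the cone (checked on polynomials)
    have hsum3 : (∑ s ∈ Finset.univ.erase z, (3 - d s) * e s) + D e =
        3 * ∑ s ∈ Finset.univ.erase z, e s := by
      simp only [D, Finset.mul_sum, ← Finset.sum_add_distrib]
      refine Finset.sum_congr rfl fun s _ => ?_
      have := hd_le s
      rw [← add_mul, Nat.sub_add_cancel (by omega)]
    have hK : 3 * N + ∑ s ∈ Finset.univ.erase z, (3 - d s) * e s =
        e z + 3 * ∑ s ∈ Finset.univ.erase z, e s := by omega
    have hA : g ^ N * ∏ s ∈ Finset.univ.erase z, mA s ^ e s =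
        ⟨monomial e 1, monomial_mem_cone k n w he 1⟩ * g ^ (∑ s ∈ Finset.univ.erase z, e s) := by
      apply Subtype.ext
      simp only [Subalgebra.coe_mul, Subalgebra.coe_pow, SubmonoidClass.coe_finsetProd, hmA, hg]
      rw [monomial_one_eq_prod_X_pow, ← Finset.mul_prod_erase _ _ (Finset.mem_univ z)]
      simp only [mul_pow, ← pow_mul, Finset.prod_mul_distrib, Finset.prod_pow_eq_pow_sum]
      calc _ = (X z : MvPolynomial (Fin n) k) ^ (3 * N + ∑ s ∈ Finset.univ.erase z, (3 - d s) * e s) *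
              ∏ s ∈ Finset.univ.erase z, X s ^ e s := by ring
        _ = X z ^ (e z + 3 * ∑ s ∈ Finset.univ.erase z, e s) *
              ∏ s ∈ Finset.univ.erase z, X s ^ e s := by rw [hK]
        _ = _ := by ring
    have hA' := congrArg am hA
    simp only [map_mul, map_pow, map_prod] at hA'
    rw [hL, hA', mul_assoc, ← mul_pow, hinv, one_pow, mul_one]
  -- the monomials of weight `0` are values of the chart map
  have hmono : ∀ (e : Fin n →₀ ℕ) (he : Finsupp.weight w e = 0),
      am ⟨monomial e 1, monomial_mem_cone k n w he 1⟩ ∈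
        Set.range (φ : MvPolynomial (Fin n) k →+* L) := by
    intro e he
    obtain ⟨N, hN⟩ := hdiv e he
    exact ⟨_, master e he N hN⟩
  have hbase : ∀ r : cone k n w, am r ∈ Set.range (φ : MvPolynomial (Fin n) k →+* L) := by
    rintro ⟨f, hf⟩
    let μ : (Fin n →₀ ℕ) → cone k n w := fun e =>
      if he : Finsupp.weight w e = 0 then ⟨monomial e 1, monomial_mem_cone k n w he 1⟩ else 0
    have hμ : ∀ (e) (he : e ∈ f.support), μ e = ⟨monomial e 1,
        monomial_mem_cone k n w (hf (Finsupp.mem_support_iff.mp he)) 1⟩ := by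
      intro e he
      have hwe : Finsupp.weight w e = 0 := hf (Finsupp.mem_support_iff.mp he)
      simp [μ, hwe]
    have hdec : (⟨f, hf⟩ : cone k n w) = ∑ e ∈ f.support, coeff e f • μ e := by
      apply Subtype.ext
      change f = ((∑ e ∈ f.support, coeff e f • μ e : cone k n w) : MvPolynomial (Fin n) k)
      rw [AddSubmonoidClass.coe_finsetSum]
      conv_lhs => rw [f.as_sum]
      refine Finset.sum_congr rfl fun e he => ?_
      rw [Subalgebra.coe_smul, hμ e he, smul_monomial, smul_eq_mul, mul_one]
    rw [hdec, map_sum]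
    have hmemR : ∀ e ∈ f.support, am (coeff e f • μ e) ∈ φ.range := by
      intro e he
      have hsm : am (coeff e f • μ e) = algebraMap k L (coeff e f) * am (μ e) := by
        rw [Algebra.smul_def, map_mul, IsScalarTower.algebraMap_apply k (cone k n w) L]
      rw [hsm]
      refine Subalgebra.mul_mem _ (Subalgebra.algebraMap_mem _ _) ?_
      rw [hμ e he]
      obtain ⟨Q, hQ⟩ := hmono e (hf (Finsupp.mem_support_iff.mp he))
      exact φ.mem_range.mpr ⟨Q, hQ⟩
    exact φ.mem_range.mp (Subalgebra.sum_mem _ hmemR)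
  -- (III) the generators `c i / g` are values of the chart map
  have hgen : ∀ i, am (c i) * ι ∈ Set.range (φ : MvPolynomial (Fin n) k →+* L) := by
    intro i
    let vv := (Fintype.equivFin (VIdx n w)).symm i
    have he0 : Finsupp.weight w (vertexExp n w vv) = 0 := weight_vertexExp n w vv
    obtain ⟨N, hN⟩ := hdiv _ he0
    obtain ⟨s₀, hs₀w, hs₀e⟩ := exists_pos_vertexExp n w vv
    have hNpos : 1 ≤ N := by
      by_contra hN0
      have hzero : vertexExp n w vv z + D (vertexExp n w vv) = 0 := by omega
      by_cases hsz : s₀ = z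
      · rw [hsz] at hs₀e; omega
      · have hle : d s₀ * vertexExp n w vv s₀ ≤ D (vertexExp n w vv) :=
          Finset.single_le_sum (f := fun s => d s * vertexExp n w vv s) (fun _ _ => Nat.zero_le _)
            (Finset.mem_erase.mpr ⟨hsz, Finset.mem_univ _⟩)
        have h1 : 1 ≤ d s₀ * vertexExp n w vv s₀ := Nat.mul_le_mul (hdpos s₀ hs₀w) hs₀e
        omega
    have hm := master _ he0 N hN
    have hcg : (⟨monomial (vertexExp n w vv) 1, monomial_mem_cone k n w he0 1⟩ : cone k n w) = c i :=
      Subtype.ext rfl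
    rw [hcg, ← Nat.sub_add_cancel hNpos, pow_succ', mul_assoc, map_mul, hφz] at hm
    -- hm : am g * φ Q = am (c i)
    refine ⟨X z ^ (N - 1) * ∏ s ∈ Finset.univ.erase z, X s ^ vertexExp n w vv s, ?_⟩
    rw [RingHom.coe_coe]
    calc φ (X z ^ (N - 1) * ∏ s ∈ Finset.univ.erase z, X s ^ vertexExp n w vv s)
        = φ (X z ^ (N - 1) * ∏ s ∈ Finset.univ.erase z, X s ^ vertexExp n w vv s) * (am g * ι) := by
          rw [hinv, mul_one]
      _ = am (c i) * ι := by rw [← hm]; ring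
  -- (IV) injectivity: `Ψ ∘ Θ ∘ φ = alg ∘ E`
  let A' := Localization.Away (X z : MvPolynomial (Fin n) k)
  let alg : MvPolynomial (Fin n) k →+* A' := algebraMap _ A'
  have halg : Function.Injective alg :=
    JordanThree.algebraMap_away_injective k n (X z) (X_ne_zero z)
  let θ : cone k n w →+* MvPolynomial (Fin n) k := (cone k n w).val.toRingHom
  have hθ : ∀ r : cone k n w, θ r = (r : MvPolynomial (Fin n) k) := fun r => rfl
  have hunit : IsUnit ((alg.comp θ) g) := by
    change IsUnit (alg (θ g))
    rw [hθ, hg, map_pow]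
    exact (IsLocalization.Away.algebraMap_isUnit (S := A') (X z)).pow 3
  let Θ : L →+* A' := IsLocalization.Away.lift g hunit
  have hΘam : ∀ r, Θ (am r) = alg (r : MvPolynomial (Fin n) k) := fun r =>
    IsLocalization.Away.lift_eq g hunit r
  have hΘι : alg (X z) ^ 3 * Θ ι = 1 := by
    have h : Θ (am g * ι) = 1 := by rw [hinv, map_one]
    rwa [map_mul, hΘam, hg, map_pow] at h
  let ψ : MvPolynomial (Fin n) k →ₐ[k] MvPolynomial (Fin n) k :=
    aeval fun s => if s = z then X z else X s * X z ^ d s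
  have hψz : ψ (X z) = X z := by simp [ψ]
  have hψs : ∀ s, s ≠ z → ψ (X s) = X s * X z ^ d s := fun s hs => by simp [ψ, hs]
  have hψC : ∀ r : k, ψ (C r) = C r := fun r => ψ.commutes r
  have hle : Submonoid.powers (X z : MvPolynomial (Fin n) k) ≤
      (Submonoid.powers (X z : MvPolynomial (Fin n) k)).comap
        (ψ : MvPolynomial (Fin n) k →+* MvPolynomial (Fin n) k) := by
    rintro _ ⟨m, rfl⟩
    exact ⟨m, by rw [RingHom.coe_coe, map_pow, hψz]⟩
  let Ψ : A' →+* A' :=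
    IsLocalization.map A' (ψ : MvPolynomial (Fin n) k →+* MvPolynomial (Fin n) k) hle
  have hΨ : ∀ f, Ψ (alg f) = alg (ψ f) := fun f => IsLocalization.map_eq hle f
  have hΨΘι : alg (X z) ^ 3 * Ψ (Θ ι) = 1 := by
    have h := congrArg Ψ hΘι
    rwa [map_mul, map_pow, hΨ, hψz, map_one] at h
  let E : MvPolynomial (Fin n) k →ₐ[k] MvPolynomial (Fin n) k :=
    aeval fun s => if s = z then X z ^ 3 else X s
  have hEz : E (X z) = X z ^ 3 := by simp [E]
  have hEs : ∀ s, s ≠ z → E (X s) = X s := fun s hs => by simp [E, hs]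
  have hEC : ∀ r : k, E (C r) = C r := fun r => E.commutes r
  have hcomp : (Ψ.comp Θ).comp (φ : MvPolynomial (Fin n) k →+* L) =
      alg.comp (E : MvPolynomial (Fin n) k →+* MvPolynomial (Fin n) k) := by
    refine MvPolynomial.ringHom_ext (fun r => ?_) (fun s => ?_)
    · simp only [RingHom.coe_comp, RingHom.coe_coe, Function.comp_apply]
      rw [hφC, hΘam, Subalgebra.coe_algebraMap, MvPolynomial.algebraMap_eq, hΨ, hψC, hEC]
    · simp only [RingHom.coe_comp, RingHom.coe_coe, Function.comp_apply]
      by_cases hs : s = z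
      · rw [hs, hφz, hΘam, hg, hΨ, map_pow, hψz, hEz]
      · have h33 : d s + (3 - d s) = 3 := by have := hd_le s; omega
        rw [hφs s hs, map_mul, hΘam, hmA, map_mul Ψ, hΨ, map_mul ψ, hψs s hs, map_pow, hψz,
          mul_assoc (X s), ← pow_add, h33, map_mul alg, map_pow, mul_assoc, hΨΘι, mul_one,
          hEs s hs]
  have hinj : Function.Injective (φ : MvPolynomial (Fin n) k →+* L) := by
    intro p q hpq
    have h1 : alg (E p) = alg (E q) := by
      have h := congrArg (Ψ.comp Θ) hpq
      have hp := RingHom.congr_fun hcomp p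
      have hq := RingHom.congr_fun hcomp q
      rw [RingHom.comp_apply] at hp hq
      rw [hp, hq] at h
      simpa only [RingHom.coe_comp, RingHom.coe_coe, Function.comp_apply] using h
    have h2 : E p = E q := halg h1
    exact ToricExit.powSubst_injective k n z 3 (by norm_num) h2
  -- conclusion
  have hrange := JordanThree.range_eq_blowupAlgebra_of_chart c j
    (φ : MvPolynomial (Fin n) k →+* L) hmem hbase hgen
  exact JordanThree.isRegularRing_chartRing_of_chart c j (φ : MvPolynomial (Fin n) k →+* L)
    hinj hrange

end Summit.ResolutionOfSingularities.ResolutionOfSingularities.Theorems.WildQuotientResolution.ThirdCone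

end
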